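import Summits.QuantumAdvantage.QuantumAdvantage.Theorems.WbwObfuscatedGluedTreesKowGenVocabulary
import Literature.Computability.QuantumComplexity.ForrelationCircuitCode
import Literature.Computability.Complexity.CodeFPStringKit
import Literature.Computability.Complexity.CodeFPTableKit

/-!
# `WbwObfuscatedGluedTrees` (stmt-QuantumAdvantage-2340) — line `knowledge-of-walk-split`, STAGE 3:
# a polynomial-time evaluator of the evaluating walk model (`stub_walkEvaluator`)

Helper file of the line `knowledge-of-walk-split` of crux `WbwObfuscatedGluedTrees` (route `WhiteBoxWalk`),
lead prover-line-stmt-QuantumAdvantage-2340-c2-0, registered stub `stub_walkEvaluator`.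

THE STATEMENT. Some `ev ∈ FP` maps `⟨⟨u, ⟨code C, e⟩⟩, code of w⟩` (any prefix `u`; the walk-word
`w : List ℕ` coded by `encodingListNatBool`) to `(evalModel.endpoint ⟨code C, e⟩ w).getD []`: the endpoint
of the walk `w` (read right to left) from the ENTRANCE `e` in the EVALUATING walk model `evalModel` of
`WbwObfuscatedGluedTreesKowGenVocabulary.lean` (decode the sized circuit from its code, check the arities,
evaluate its answer string bit by bit, read the listed names back with the generator's `decodeAnswer`).

THE PROOF is written in the typed algebra `CodeFP` (`CodeFP.lean`: `CodeFP eα eβ g` = some `f ∈ FP` has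
`f (eα a) = eβ (g a)`), on the type `(List Bool × (SizedCircuit × List Bool)) × List ℕ` coded by
`pairE (pairE strE (pairE encodeSizedCircuit strE)) (listE natE)` — sized circuits are coded by
`encodeSizedCircuit` ITSELF, so no decoder is ever run: the circuit is evaluated on its code by the generic
evaluator `ForrCode.evalP_codeFP` of `ForrelationCircuitCode.lean`
(`encodeSizedCircuit ⟨n, C⟩ = ⟨bin n, pcE (pcircOf C)⟩`, `ForrCode.evalP_pcircOf_eq`).  Steps: the query input
as a bit list (`queryInput_eq_toInput`); the answer string (`answerOf_codeFP`, a `map` over the `3N + 2`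
positions); the listed names (`namesOf_codeFP`, nested `map`s); the neighbour listing (`evalNbrs_codeFP`, two
equality tests and `listing`); one letter of the walk (`step_codeFP`, two `Option.bind`s and an indexing); the
walk as a left fold over the reversed word (`foldl_codeFP`; the accumulator is an optional name of length
`|e|`, `foldl_step_length`, so the fold is polynomially bounded); `endpoint_eq_foldl`.

## References

* S. Arora, B. Barak, *Computational Complexity: A Modern Approach*, CUP 2009, §1.3 (closure of polynomial time
  under composition and polynomially bounded loops), §6.1 (evaluating a circuit from its description).
* A. M. Childs, R. Cleve, E. Deotto, E. Farhi, S. Gutmann, D. A. Spielman, *Exponential algorithmic speedup by a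
  quantum walk*, STOC 2003, §2 (vertex names, the neighbour oracle, walks from the ENTRANCE).
-/

set_option linter.dupNamespace false

namespace Summit.QuantumAdvantage.QuantumAdvantage.Theorems.WbwObfuscatedGluedTrees.KnowledgeOfWalk.Generator

open Literature.Computability.Cryptography Literature.Computability.Complexity
open Literature.Computability.Cryptography.ObfuscatedGluedTrees
open Literature.Computability.QuantumComplexity
open Literature.Computability.Complexity.CodeFP
open Summit.QuantumAdvantage.QuantumAdvantage.Theorems.WbwObfuscatedGluedTrees.KnowledgeOfWalk (WalkModel)

/-! ## §1 The answer string and the listed names as list programs -/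

/-- `List.ofFn` of a function of the value is a `map` over `List.range`. [folklore] -/
private theorem ofFn_eq_map_range {α : Type} (n : ℕ) (F : ℕ → α) :
    (List.ofFn fun i : Fin n => F i) = (List.range n).map F := by
  apply List.ext_getElem
  · simp
  · intro i h₁ h₂
    rw [List.getElem_ofFn, List.getElem_map, List.getElem_range]

/-- The query input of the neighbour circuit read off the bit LIST `(first N bits of y, padded with 0) ++
(the N binary digits of t, least significant first)` (wires beyond the list read `false`). [folklore] -/
private theorem queryInput_eq_toInput (N m : ℕ) (y : List Bool) (t : ℕ) :
    queryInput N m y t = ForrCode.toInput m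
      (((List.range N).map fun i => y.getD i false) ++ (List.range N).map fun i => t.testBit i) := by
  funext i
  have hl₁ : ((List.range N).map fun i => y.getD i false).length = N := by simp
  have hl₂ : ((List.range N).map fun i => t.testBit i).length = N := by simp
  unfold queryInput ForrCode.toInput
  by_cases h : (i : ℕ) < N + N
  · rw [dif_pos h]
    by_cases hi : (i : ℕ) < N
    · rw [List.getD_append _ _ _ _ (by rw [hl₁]; exact hi),
        List.getD_eq_getElem _ _ (by rw [hl₁]; exact hi), List.getElem_map, List.getElem_range]
      exact Fin.append_left (vecOf N y) (GluedTrees.nameOfVal N t) ⟨i, hi⟩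
    · have hi' : (i : ℕ) - N < N := by omega
      rw [List.getD_append_right _ _ _ _ (by rw [hl₁]; exact Nat.le_of_not_lt hi), hl₁,
        List.getD_eq_getElem _ _ (by rw [hl₂]; exact hi'), List.getElem_map, List.getElem_range]
      have hnat : (⟨i, h⟩ : Fin (N + N)) = Fin.natAdd N ⟨i - N, hi'⟩ :=
        Fin.ext (by simp only [Fin.natAdd_mk]; omega)
      rw [hnat, Fin.append_right]
      rfl
  · rw [dif_neg h, List.getD_eq_default _ _ (by rw [List.length_append, hl₁, hl₂]; omega)]

/-- The answer string as a `map` over the `ansLen N` positions, the circuit evaluated on bit lists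
(`ForrCode.toInput`). [folklore] -/
private theorem answerOf_eq_map (N : ℕ) (C : SizedCircuit) (y : List Bool) :
    answerOf N C y = (List.range (ansLen N)).map fun t => C.2.eval (ForrCode.toInput C.1
      (((List.range N).map fun i => y.getD i false) ++ (List.range N).map fun i => t.testBit i)) := by
  unfold answerOf
  rw [ofFn_eq_map_range (ansLen N) (fun t => C.2.eval (queryInput N C.1 y t))]
  exact List.map_congr_left fun t _ => by rw [queryInput_eq_toInput]

/-- The listed names as nested `map`s over ranges. [folklore] -/
private theorem namesOf_eq_map (N : ℕ) (w : List Bool) :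
    namesOf N w = (List.range (min (ansCount w) 3)).map fun j =>
      (List.range N).map fun i => w.getD (2 + j * N + i) false := by
  apply List.ext_getElem
  · simp [namesOf, decodeAnswer]
  · intro j h₁ h₂
    simp only [namesOf, decodeAnswer, List.getElem_map, List.getElem_ofFn, List.getElem_range]
    exact ofFn_eq_map_range N fun i => w.getD (2 + j * N + i) false

/-- Every listed name has length `N`. [folklore] -/
private theorem length_of_mem_namesOf {N : ℕ} {w x : List Bool} (h : x ∈ namesOf N w) : x.length = N := by
  unfold namesOf at h
  obtain ⟨f, -, rfl⟩ := List.mem_map.1 h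
  exact List.length_ofFn

/-- `listing L = some L'` forces `L' = L`. [folklore] -/
private theorem eq_of_listing_eq_some {L L' : List (List Bool)} (h : listing L = some L') : L' = L := by
  cases L with
  | nil => exact absurd h (by simp)
  | cons l L => rw [listing_cons, Option.some.injEq] at h; exact h.symm

/-- The neighbour listing of a coded instance, unfolded (`decodeSC_encodeSizedCircuit`). [folklore] -/
private theorem evalNbrs_boolPair (C : SizedCircuit) (e y : List Bool) :
    evalNbrs (boolPair (encodeSizedCircuit C) e) y =
      if C.1 = e.length + e.length ∧ y.length = e.length then
        listing (namesOf e.length (answerOf e.length C y)) else none := by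
  simp only [evalNbrs, boolUnpair_boolPair, decodeSC_encodeSizedCircuit]

/-- `endpoint` is a right fold over the word, i.e. a left fold over the reversed word. [folklore] -/
private theorem endpoint_eq_foldl (M : WalkModel) (x : List Bool) (w : List ℕ) :
    M.endpoint x w = w.reverse.foldl
      (fun acc i => acc.bind fun cur => (M.nbrs x cur).bind fun L => L[i]?) (some (M.entrance x)) := by
  rw [List.foldl_reverse]
  induction w with
  | nil => rfl
  | cons i w ih => rw [List.foldr_cons, WalkModel.endpoint_cons, ih]

/-- **The walk stays on names of length `|e|`**: the invariant of the fold's accumulator. [folklore] -/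
private theorem foldl_step_length (C : SizedCircuit) (e : List Bool) :
    ∀ (l : List ℕ) (acc : Option (List Bool)), (∀ cur, acc = some cur → cur.length = e.length) →
      ∀ cur, l.foldl (fun acc i => acc.bind fun cur =>
          (evalNbrs (boolPair (encodeSizedCircuit C) e) cur).bind fun L => L[i]?) acc = some cur →
        cur.length = e.length
  | [], _, hacc => hacc
  | i :: l, acc, _ => by
    rw [List.foldl_cons]
    refine foldl_step_length C e l _ fun cur hcur => ?_
    obtain ⟨a, -, ha⟩ := Option.bind_eq_some_iff.1 hcur
    obtain ⟨L, hL, hLi⟩ := Option.bind_eq_some_iff.1 ha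
    rw [evalNbrs_boolPair] at hL
    by_cases h : C.1 = e.length + e.length ∧ a.length = e.length
    · rw [if_pos h] at hL
      rw [eq_of_listing_eq_some hL] at hLi
      exact length_of_mem_namesOf (List.mem_of_getElem? hLi)
    · rw [if_neg h] at hL
      exact absurd hL.symm (Option.some_ne_none L)

/-- The accumulator's code is short: `|optE strE acc| ≤ 2|e| + 2` along the fold from `some e`. [folklore] -/
private theorem length_optE_foldl_le (C : SizedCircuit) (e : List Bool) (l : List ℕ) :
    (optE strE (l.foldl (fun acc i => acc.bind fun cur =>
      (evalNbrs (boolPair (encodeSizedCircuit C) e) cur).bind fun L => L[i]?) (some e))).length ≤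
      2 * e.length + 2 := by
  have hinv := foldl_step_length C e l (some e) (fun cur h => by cases h; rfl)
  revert hinv
  cases l.foldl (fun acc i => acc.bind fun cur =>
      (evalNbrs (boolPair (encodeSizedCircuit C) e) cur).bind fun L => L[i]?) (some e) with
  | none => intro; simp
  | some cur =>
    intro hinv
    have h := hinv cur rfl
    simp only [optE_some, length_boolPair, List.length_nil]
    change 2 * cur.length + 2 + 0 ≤ 2 * e.length + 2
    omega

/-! ## §2 The pieces on codes -/

/-- The bit list handed to the circuit: `((1ᴺ, y), t) ↦ (first N bits of y) ++ (N binary digits of t)`.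
[cite: AroraBarak2009, §1.3] -/
private theorem queryList_codeFP : CodeFP (pairE (pairE unE strE) natE) strE
    (fun q => ((List.range q.1.1).map fun i => q.1.2.getD i false) ++
      (List.range q.1.1).map fun i => q.2.testBit i) := by
  have hr : CodeFP (pairE (pairE unE strE) natE) (rawE natE) (fun q => List.range q.1.1) :=
    urange.comp (fst _ _).fst'
  have h1 := CodeFP.map (σ := List Bool) (eσ := strE) (α := ℕ) (eα := natE) (eβ := bitE)
    (g := fun r => r.1.getD r.2 false) strGetDNat
  have h2 := CodeFP.map (σ := ℕ) (eσ := natE) (α := ℕ) (eα := natE) (eβ := bitE)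
    (g := fun r => Nat.testBit r.1 r.2) testBitNat
  exact (strAppend.comp ((bitsToStr.comp (h1.comp ((fst _ _).snd'.pair hr))).pair
    (bitsToStr.comp (h2.comp ((snd _ _).pair hr))))).congr fun _ => rfl

/-- **The answer string on codes**: `(e, C, y) ↦ answerOf |e| C y` — a `map` over the `3|e| + 2` positions of
the coded circuit's value on the query bit list (`ForrCode.evalP_codeFP`, `ForrCode.evalP_pcircOf_eq`).
[cite: AroraBarak2009, §1.3 and §6.1] -/
private theorem answerOf_codeFP : CodeFP (pairE strE (pairE encodeSizedCircuit strE)) strE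
    (fun p => answerOf p.1.length p.2.1 p.2.2) := by
  -- evaluation of the coded circuit on a bit list
  have hpc : CodeFP encodeSizedCircuit ForrCode.pcE (fun C => ForrCode.pcircOf C.2) :=
    of_fn Brick.sndF Brick.sndF_mem_FP fun C => by
      rw [encodeSizedCircuit, Brick.sndF_boolPair, ForrCode.encodeCircuit_eq]
  have hev : CodeFP (pairE encodeSizedCircuit strE) bitE
      (fun p => p.1.2.eval (ForrCode.toInput p.1.1 p.2)) :=
    (ForrCode.evalP_codeFP.comp ((hpc.comp (fst _ _)).pair (snd _ _))).congr fun p =>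
      ForrCode.evalP_pcircOf_eq _ _
  -- context `p = (e, C, y)`, item `t`
  have hN : CodeFP (pairE (pairE strE (pairE encodeSizedCircuit strE)) natE) unE (fun q => q.1.1.length) :=
    strLength.comp (fst _ _).fst'
  have hq := queryList_codeFP.comp ((hN.pair (fst _ _).snd'.snd').pair (snd _ _))
  have hbit : CodeFP (pairE (pairE strE (pairE encodeSizedCircuit strE)) natE) bitE
      (fun q => q.1.2.1.2.eval (ForrCode.toInput q.1.2.1.1
        (((List.range q.1.1.length).map fun i => q.1.2.2.getD i false) ++
          (List.range q.1.1.length).map fun i => q.2.testBit i))) :=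
    (hev.comp ((fst _ _).snd'.fst'.pair hq)).congr fun _ => rfl
  have hlen : CodeFP (pairE strE (pairE encodeSizedCircuit strE)) unE (fun p => ansLen p.1.length) :=
    (unSucc.comp (unSucc.comp ((unMulConst 3).comp (strLength.comp (fst _ _))))).congr fun _ => rfl
  refine (bitsToStr.comp ((CodeFP.map hbit).comp ((CodeFP.id _).pair (urange.comp hlen)))).congr
    fun p => ?_
  exact (answerOf_eq_map p.1.length p.2.1 p.2.2).symm

/-- **The listed names on codes**: `(1ᴺ, w) ↦ namesOf N w` (the count off two bits, then nested `map`s of bit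
accesses). [cite: AroraBarak2009, §1.3] -/
private theorem namesOf_codeFP : CodeFP (pairE unE strE) (rawE strE) (fun p => namesOf p.1 p.2) := by
  have htoNat : CodeFP bitE natE Bool.toNat := ofFintype bitE_injective natE Bool.toNat
  have hb : ∀ k : ℕ, CodeFP strE natE (fun w => (w.getD k false).toNat) := fun k =>
    (htoNat.comp (strGetDNat.comp ((CodeFP.id _).pair (const _ k)))).congr fun _ => rfl
  have hcnt : CodeFP strE natE ansCount :=
    (natAdd.comp ((hb 0).pair (natMul.comp ((const _ 2).pair (hb 1))))).congr fun _ => rfl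
  have hjs : CodeFP (pairE unE strE) (rawE natE) (fun p => List.range (min (ansCount p.2) 3)) :=
    (urange.comp (unOfNatMin.comp ((const _ 3).pair (hcnt.comp (snd _ _))))).congr fun _ => rfl
  -- the `j`-th name: context `r = ((N, w), j)`, item `i`
  have hidx : CodeFP (pairE (pairE (pairE unE strE) natE) natE) natE
      (fun s => 2 + s.1.2 * s.1.1.1 + s.2) :=
    (natAdd.comp ((natAdd.comp ((const _ 2).pair (natMul.comp
      ((fst _ _).snd'.pair (natOfUn.comp (fst _ _).fst'.fst'))))).pair (snd _ _))).congr fun _ => rfl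
  have hin : CodeFP (pairE (pairE (pairE unE strE) natE) natE) bitE
      (fun s => s.1.1.2.getD (2 + s.1.2 * s.1.1.1 + s.2) false) :=
    (strGetDNat.comp ((fst _ _).fst'.snd'.pair hidx)).congr fun _ => rfl
  have hname : CodeFP (pairE (pairE unE strE) natE) strE
      (fun r => (List.range r.1.1).map fun i => r.1.2.getD (2 + r.2 * r.1.1 + i) false) :=
    (bitsToStr.comp ((CodeFP.map hin).comp ((CodeFP.id _).pair (urange.comp (fst _ _).fst')))).congr
      fun _ => rfl
  refine ((CodeFP.map hname).comp ((CodeFP.id _).pair hjs)).congr fun p => ?_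
  exact (namesOf_eq_map p.1 p.2).symm

/-- `listing` on codes (an emptiness test). [folklore] -/
private theorem listing_codeFP : CodeFP (rawE strE) (optE (rawE strE)) listing :=
  ((rawIsEmpty strE).ite (const _ none) (optSome (rawE strE))).congr fun L => by
    cases L <;> rfl

/-- **The neighbour listing on codes**: `((C, e), y) ↦ evalNbrs ⟨code C, e⟩ y` (two arity tests, then the
listed names of the answer string). [cite: AroraBarak2009, §1.3] -/
private theorem evalNbrs_codeFP : CodeFP (pairE (pairE encodeSizedCircuit strE) strE) (optE (rawE strE))
    (fun q => evalNbrs (boolPair (encodeSizedCircuit q.1.1) q.1.2) q.2) := by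
  have har : CodeFP encodeSizedCircuit natE (fun C => C.1) :=
    of_fn Brick.fstF Brick.fstF_mem_FP fun C => by rw [encodeSizedCircuit, Brick.fstF_boolPair]
  have hC1 : CodeFP (pairE (pairE encodeSizedCircuit strE) strE) natE (fun q => q.1.1.1) :=
    har.comp (fst _ _).fst'
  have hN : CodeFP (pairE (pairE encodeSizedCircuit strE) strE) natE (fun q => q.1.2.length) :=
    strNatLength.comp (fst _ _).snd'
  have hy : CodeFP (pairE (pairE encodeSizedCircuit strE) strE) natE (fun q => q.2.length) :=
    strNatLength.comp (snd _ _)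
  have hcond : CodeFP (pairE (pairE encodeSizedCircuit strE) strE) bitE
      (fun q => decide (q.1.1.1 = q.1.2.length + q.1.2.length) && decide (q.2.length = q.1.2.length)) :=
    (natEq.comp (hC1.pair (natAdd.comp (hN.pair hN)))).and (natEq.comp (hy.pair hN))
  have hbody : CodeFP (pairE (pairE encodeSizedCircuit strE) strE) (optE (rawE strE))
      (fun q => listing (namesOf q.1.2.length (answerOf q.1.2.length q.1.1 q.2))) :=
    listing_codeFP.comp (namesOf_codeFP.comp ((strLength.comp (fst _ _).snd').pair
      (answerOf_codeFP.comp ((fst _ _).snd'.pair ((fst _ _).fst'.pair (snd _ _))))))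
  refine (hcond.ite hbody (const _ none)).congr fun q => ?_
  rw [evalNbrs_boolPair]
  by_cases h : q.1.1.1 = q.1.2.length + q.1.2.length ∧ q.2.length = q.1.2.length
  · rw [if_pos h, if_pos (Bool.and_eq_true_iff.2 ⟨decide_eq_true h.1, decide_eq_true h.2⟩)]
  · rw [if_neg h, if_neg fun hb => h ?_]
    obtain ⟨h1, h2⟩ := Bool.and_eq_true_iff.1 hb
    exact ⟨of_decide_eq_true h1, of_decide_eq_true h2⟩

/-- `l[i]?` for a binary index `i` (capped by `|l|` in unary). [folklore] -/
private theorem getOptNat_codeFP : CodeFP (pairE natE (rawE strE)) (optE strE) (fun p => p.2[p.1]?) := by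
  refine ((getOpt strE).comp ((unOfNatMin.comp (((ulength strE).comp (snd _ _)).pair (fst _ _))).pair
    (snd _ _))).congr fun p => ?_
  obtain ⟨i, l⟩ := p
  show l[min i l.length]? = l[i]?
  rcases le_total i l.length with h | h
  · rw [min_eq_left h]
  · rw [min_eq_right h, List.getElem?_eq_none (le_refl _), List.getElem?_eq_none h]

/-- **One letter of the walk on codes**: `((C, e), i, acc) ↦ acc >>= (cur ↦ nbrs cur >>= (·[i]?))`.
[cite: AroraBarak2009, §1.3] -/
private theorem step_codeFP :
    CodeFP (pairE (pairE encodeSizedCircuit strE) (pairE natE (optE strE))) (optE strE)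
      (fun t => t.2.2.bind fun cur =>
        (evalNbrs (boolPair (encodeSizedCircuit t.1.1) t.1.2) cur).bind fun L => L[t.2.1]?) := by
  -- the inner bind, context `((C, e), i)`
  have hinner : CodeFP (pairE (pairE (pairE encodeSizedCircuit strE) natE) (optE (rawE strE))) (optE strE)
      (fun p => p.2.bind fun L => L[p.1.2]?) :=
    optBind (getOptNat_codeFP.comp ((fst _ _).snd'.pair (snd _ _)))
  have hg : CodeFP (pairE (pairE (pairE encodeSizedCircuit strE) natE) strE) (optE strE)
      (fun r => (evalNbrs (boolPair (encodeSizedCircuit r.1.1.1) r.1.1.2) r.2).bind fun L => L[r.1.2]?) :=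
    (hinner.comp ((fst _ _).pair (evalNbrs_codeFP.comp ((fst _ _).fst'.pair (snd _ _))))).congr
      fun _ => rfl
  exact ((optBind hg).comp (((fst _ _).pair (snd _ _).fst').pair (snd _ _).snd')).congr fun _ => rfl

/-- **The walk on codes**: `((C, e), letters) ↦` the left fold of the step from `some e`; the accumulator is
an optional name of length `|e|` (`length_optE_foldl_le`), so the fold is polynomially bounded.
[cite: AroraBarak2009, §1.3 (polynomially bounded loops)] -/
private theorem foldl_codeFP : CodeFP (pairE (pairE encodeSizedCircuit strE) (rawE natE)) (optE strE)
    (fun p => p.2.foldl (fun acc i => acc.bind fun cur =>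
      (evalNbrs (boolPair (encodeSizedCircuit p.1.1) p.1.2) cur).bind fun L => L[i]?) (some p.1.2)) := by
  refine (CodeFP.foldl (σ := SizedCircuit × List Bool) (α := ℕ) (β := Option (List Bool))
    (eσ := pairE encodeSizedCircuit strE) (eα := natE) (eβ := optE strE)
    (step := fun s i acc => acc.bind fun cur =>
      (evalNbrs (boolPair (encodeSizedCircuit s.1) s.2) cur).bind fun L => L[i]?)
    (init := fun s => some s.2) step_codeFP ((optSome strE).comp (snd _ _)) Polynomial.X
    fun s l₁ l₂ => ?_).congr fun _ => rfl
  refine (length_optE_foldl_le s.1 s.2 l₁).trans ?_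
  rw [Polynomial.eval_X, pairE_apply, length_boolPair, pairE_apply, length_boolPair]
  change 2 * s.2.length + 2 ≤
    2 * (2 * (encodeSizedCircuit s.1).length + 2 + s.2.length) + 2 + (rawE natE (l₁ ++ l₂)).length
  omega

/-! ## §3 The stub -/

/-- **STUB A — a polynomial-time evaluator of the evaluating walk model.**  Some `ev ∈ FP` maps
`⟨⟨u, ⟨code C, e⟩⟩, code of w⟩` (any prefix `u`, e.g. `1ⁿ`; `w` coded by `encodingListNatBool`) to the
endpoint of the walk-word `w` from `e` in `evalModel` on the instance `⟨code C, e⟩` (`[]` when the walk leaves the valid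
names): read as a `CodeFP` statement on `((u, (C, e)), w)` it is `foldl_codeFP` over the reversed word
(`endpoint_eq_foldl`) followed by `Option.getD`. [cite: AroraBarak2009, §1.3 and §6.1] -/
theorem stub_walkEvaluator :
    ∃ ev : List Bool → List Bool, PolyTimeComputable (id : List Bool → List Bool) (id : List Bool → List Bool) ev ∧
      ∀ (u e : List Bool) (C : SizedCircuit) (w : List ℕ),
        ev (boolPair (boolPair u (boolPair (encodeSizedCircuit C) e)) (encodingListNatBool.encode w)) =
          (evalModel.endpoint (boolPair (encodeSizedCircuit C) e) w).getD [] := by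
  have hgetD : CodeFP (optE strE) strE (fun o => o.getD []) :=
    ((rawHeadD strE (d := []) rfl).comp (optToList strE)).congr fun o => by cases o <;> rfl
  have hw : CodeFP (pairE (pairE strE (pairE encodeSizedCircuit strE)) (listE natE)) (rawE natE)
      (fun p => p.2.reverse) :=
    ((rawReverse natE).comp ((rawOfList natE).comp (snd _ _))).congr fun _ => rfl
  have hend : CodeFP (pairE (pairE strE (pairE encodeSizedCircuit strE)) (listE natE)) (optE strE)
      (fun p => evalModel.endpoint (boolPair (encodeSizedCircuit p.1.2.1) p.1.2.2) p.2) :=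
    (foldl_codeFP.comp ((fst _ _).snd'.pair hw)).congr fun p => by
      rw [endpoint_eq_foldl]
      simp only [evalModel, boolUnpair_boolPair]
  obtain ⟨f, hf, hfg⟩ := hgetD.comp hend
  refine ⟨f, hf, fun u e C w => ?_⟩
  have hl : encodingListNatBool.encode w = listE natE w := congrFun (listE_eq _root_.Computability.encodingNatBool) w
  rw [hl]
  exact hfg ((u, (C, e)), w)

end Summit.QuantumAdvantage.QuantumAdvantage.Theorems.WbwObfuscatedGluedTrees.KnowledgeOfWalk.Generator
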